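import Literature.AlgebraicGeometry.AbelianSchemes.AbelianSchemeOverMulNUnramified
import Literature.AlgebraicGeometry.AbelianSchemes.AbelianSchemeOverLevelBaseChange
import Literature.AlgebraicGeometry.AbelianSchemes.AbelianSchemeOverSectionsBaseChange
import Literature.AlgebraicGeometry.FundamentalGroup.EtaleExtensionOfLiftings
import HarnessLib

/-!
# Torsion sections and level structures of an abelian scheme are rigid and lift uniquely along nilpotent thickenings

Topic `Literature/AlgebraicGeometry/AbelianSchemes`; namespace `Literature.AlgebraicGeometry.AbelianSchemes.AbelianSchemeOver`;
THEOREMS ONLY (no definition, no named fact, no instance, no `sorry`).  Cell hodgecm-mathlib (D-0151), SOCKETS-F §4 (α)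
«EQUIDIM BY PROOF» node **E5** «level-`N` structures lift uniquely along `k[ε] → k`» (census
`A-provers/A-p01/E-census-E3E5.A-p01g8.md`; B-plan1 (g13) 17:41:11Z GO); count-neutral capital; seat A-p01 (g8).

THE PRINT.  [GortzWedhorn2023] Prop. 27.187 / [BLRNeronModels1990] §7.3 Prop. 2 (Lemma 1): for an abelian scheme `X → S` and
`N` invertible on `S`, «multiplication by `N`» `[N] : X → X` is ÉTALE (the tree has the unramified half ★
`AbelianSchemeOver.formallyUnramified_pow_id_left`); [SGA1] Exp. I Thm. 5.5 / Cor. 5.6 («théorème de prolongement des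
relèvements»): morphisms into an étale `X`-scheme extend uniquely along a surjective closed immersion `S₀ → S`, and into an
UNRAMIFIED one they are at least unique (Cor. 5.4; ★ `FundamentalGroup.hom_ext_of_surjective`,
`existsUnique_lift_of_etale`).  Read on `S`-points of `X` over `[N]`, i.e. on `N`-TORSION SECTIONS, this gives the rigidity
and the unique infinitesimal lifting of level-`N` structures ([MumfordFogartyKirwan1994] Ch. 7 §2 Def. 7.1; the «lemma of
Serre» remark after Thm. 7.9 is the same rigidity over a connected base) — the statement a deformation-theoretic count of
`dim T_x 𝒜_{g,δ,N}` uses to see that the level structure contributes nothing to the tangent space.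

WHAT IS HERE (`A : AbelianSchemeOver S`, `[N] := (𝟙 A.X) ^ N` in Mathlib's `Hom.monoid`):
* `pow_eq_comp_pow_id` — `σ ^ N = σ ≫ [N]` for a section `σ ∈ X(S)` (Mathlib `MonObj.comp_pow`);
* **`section_eq_of_pow_eq_of_comp_left_eq`**, `section_eq_of_pow_eq_one_of_comp_left_eq` — RIGIDITY: `N` invertible in the
  residue fields of `S`, `i : S₀ → S` surjective (any morphism): two sections with `σ ^ N = τ ^ N` agreeing after `i` are equal;
* `IsBaseChangeVia.pow_id_left_comp` — `[N]` commutes with every base-change square of group schemes `(G, g) : A′ → A`;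
* **`existsUnique_section_pow_eq_one_of_comp`**, `existsUnique_section_pow_eq_one_of_isBaseChangeVia` — LIFTING: `[N]` étale,
  `i : S₀ → S` a surjective closed immersion: every `N`-torsion point of `X` over `i` (resp. `N`-torsion section of a base
  change `A′/S₀`) is the restriction of a unique `N`-torsion section of `X/S`;
* `exists_comp_eq_of_isClosedImmersion_of_surjective` — reduced (e.g. geometric) points of `S` factor through `i`
  (Mathlib `isIso_of_isClosedImmersion_of_surjective` on the base change);
* `sectionBaseChange_eq_of_left_comp_fst`, `LevelStructure.ext_of_σ_eq` — plumbing;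
* **`LevelStructure.existsUnique_baseChange_eq`** — E5: for `[N]_A` étale and `i : S₀ → S` a surjective closed immersion,
  `φ ↦ φ.baseChange i` is a BIJECTION `LevelStructure g N A → LevelStructure g N (A.baseChange i)` (every level structure on
  `X ×_S S₀` is the pull-back of a unique one on `X`).

The étaleness of `[N]` enters ONLY as the instance hypothesis `[Etale [N].left]` (discharged for `N` invertible on `S` by
the cell's `AbelianSchemeOverMulNEtale` leaf, B-p09 (g10); over `Spec k → Spec k[ε]` with `char k ∤ N` this is E5 of the
census verbatim).  The symplectic-liftable clause of the moduli object (★ `LevelStructure.IsSymplecticLiftable`, tested at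
geometric points only) transfers along `i` by `exists_comp_eq_of_isClosedImmersion_of_surjective` and ★
`IsSymplecticLiftable.of_fibreIso`; that corollary is left to the polarisation files.  HC_CM is proved only modulo the 7
printed citations until rung 0 closes; this file discharges none of them.

## References
* [GortzWedhorn2023] U. Görtz, T. Wedhorn, *Algebraic Geometry II* (2023), Prop. 27.187 (`[N]` étale, `X[N]` finite étale).
* [BLRNeronModels1990] S. Bosch, W. Lütkebohmert, M. Raynaud, *Néron Models* (1990), §7.3 Prop. 2 and Lemma 1.
* [SGA1] A. Grothendieck, M. Raynaud, *SGA 1* (LNM 224), Exp. I Cor. 5.4, Thm. 5.5, Cor. 5.6 (pp. 6–8).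
* [MumfordFogartyKirwan1994] D. Mumford, J. Fogarty, F. Kirwan, *Geometric Invariant Theory*, 3rd ed. (1994), Ch. 7 §2
  Def. 7.1, Def. 7.2 (p. 129), remark after Thm. 7.9 («lemma of Serre», p. 132).
* [GortzWedhorn2020] U. Görtz, T. Wedhorn, *Algebraic Geometry I*, 2nd ed. (2020), Section (4.7) (pp. 107–108).
-/

set_option autoImplicit false

universe u

open CategoryTheory CategoryTheory.Limits AlgebraicGeometry MonoidalCategory
open scoped MonObj CategoryTheory.Obj

noncomputable section

namespace Literature.AlgebraicGeometry.AbelianSchemes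

namespace AbelianSchemeOver

variable {S : Scheme.{u}} (A : AbelianSchemeOver S)

/-- A power `σ ^ N` of a section `σ ∈ X(S)` (Mathlib's `Hom.group` on `𝟙_ ⟶ X`) is `σ` followed by «multiplication by
`N`» `[N] = (𝟙 X) ^ N` (Mathlib `MonObj.comp_pow`). [cite: MumfordFogartyKirwan1994, Ch. 7 §2 Definition 7.1 (ii) (p. 129)] -/
theorem pow_eq_comp_pow_id (σ : A.Sections) (N : ℕ) :
    σ ^ N = σ ≫ ((𝟙 A.X : A.X ⟶ A.X) ^ N) := by
  rw [MonObj.comp_pow, Category.comp_id]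

/-- **Rigidity of torsion sections along a surjective morphism of bases** ([GortzWedhorn2023] Prop. 27.187 / [BLRNeronModels1990]
§7.3 Prop. 2, unramified half, read through [SGA1] I Cor. 5.4): let `X/S` be an abelian scheme, `N` invertible in every
residue field of `S`, and `i : S₀ → S` SURJECTIVE (e.g. a nilpotent thickening `S₀ ↪ S`, or `Spec k → Spec k[ε]`).  Two
sections `σ, τ ∈ X(S)` with `σ ^ N = τ ^ N` which agree after composition with `i` are EQUAL — because `[N] : X → X` is
formally unramified and locally of finite type (★ `formallyUnramified_pow_id_left`), so morphisms into `X` over `[N]`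
are determined by their restriction along the surjective `i` (★ `FundamentalGroup.hom_ext_of_surjective`).
[cite: GortzWedhorn2023, Prop. 27.187] [cite: SGA1, Exp. I Cor. 5.4 and Thm. 5.5] -/
theorem section_eq_of_pow_eq_of_comp_left_eq {N : ℕ} (hN : ∀ s : S, (N : S.residueField s) ≠ 0)
    {S₀ : Scheme.{u}} (i : S₀ ⟶ S) [Surjective i] {σ τ : A.Sections} (hpow : σ ^ N = τ ^ N)
    (h₀ : i ≫ σ.left = i ≫ τ.left) : σ = τ := by
  haveI := A.formallyUnramified_pow_id_left hN
  haveI := A.locallyOfFiniteType_pow_id_left N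
  have hcomp : σ.left ≫ (((𝟙 A.X : A.X ⟶ A.X) ^ N) : A.X ⟶ A.X).left =
      τ.left ≫ (((𝟙 A.X : A.X ⟶ A.X) ^ N) : A.X ⟶ A.X).left := by
    rw [← Over.comp_left, ← Over.comp_left, ← pow_eq_comp_pow_id, ← pow_eq_comp_pow_id, hpow]
  ext : 1
  exact Literature.AlgebraicGeometry.FundamentalGroup.hom_ext_of_surjective
    ((((𝟙 A.X : A.X ⟶ A.X) ^ N) : A.X ⟶ A.X).left) i h₀ hcomp

/-- **Torsion sections are rigid**: two `N`-torsion sections (`σ ^ N = 1 = τ ^ N`) of an abelian scheme, `N` invertible on the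
base, which agree on a surjective `S₀ → S` are equal. [cite: GortzWedhorn2023, Prop. 27.187] [cite: SGA1, Exp. I Cor. 5.4] -/
theorem section_eq_of_pow_eq_one_of_comp_left_eq {N : ℕ} (hN : ∀ s : S, (N : S.residueField s) ≠ 0)
    {S₀ : Scheme.{u}} (i : S₀ ⟶ S) [Surjective i] {σ τ : A.Sections} (hσ : σ ^ N = 1) (hτ : τ ^ N = 1)
    (h₀ : i ≫ σ.left = i ≫ τ.left) : σ = τ :=
  A.section_eq_of_pow_eq_of_comp_left_eq hN i (hσ.trans hτ.symm) h₀

/-! ## `[N]` commutes with a base-change square of group schemes -/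

namespace IsBaseChangeVia

variable {A} {S' : Scheme.{u}} {A' : AbelianSchemeOver S'} {g : S' ⟶ S} {G : A'.X.left ⟶ A.X.left}

/-- Along a base-change square of group schemes `(G, g) : A' → A` (`IsBaseChangeVia`: cartesian, compatible with `η` and
`μ`), «multiplication by `N`» commutes with `G`: `[N]_{A'} ≫ G = G ≫ [N]_A` on underlying schemes (induction on `N` from
the `η`- and `μ`-clauses; `(𝟙)^{N+1} = ((𝟙)^N, 𝟙) ≫ μ` in Mathlib's `Hom.monoid`).
[cite: MumfordFogartyKirwan1994, Ch. 7 §2 Definition 7.2 (p. 129)] [cite: GortzWedhorn2020, Section (4.7) (pp. 107–108)] -/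
theorem pow_id_left_comp (hG : A'.IsBaseChangeVia A g G) (N : ℕ) :
    (((𝟙 A'.X : A'.X ⟶ A'.X) ^ N) : A'.X ⟶ A'.X).left ≫ G = G ≫ (((𝟙 A.X : A.X ⟶ A.X) ^ N) : A.X ⟶ A.X).left := by
  obtain ⟨w, -, hη, hμ⟩ := hG
  induction N with
  | zero =>
    rw [pow_zero, pow_zero, Hom.one_def, Hom.one_def, Over.comp_left, Over.comp_left, Over.toUnit_left,
      Over.toUnit_left, Category.assoc, hη]
    exact ((Category.assoc _ _ _).symm.trans (congrArg (· ≫ η[A.X].left) w).symm)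
  | succ N ih =>
    have h1' : (CartesianMonoidalCategory.lift ((𝟙 A'.X : A'.X ⟶ A'.X) ^ N) (𝟙 A'.X)).left ≫
        pullback.fst A'.X.hom A'.X.hom = (((𝟙 A'.X : A'.X ⟶ A'.X) ^ N) : A'.X ⟶ A'.X).left :=
      congrArg Over.Hom.left (CartesianMonoidalCategory.lift_fst _ _)
    have h1 : (CartesianMonoidalCategory.lift ((𝟙 A.X : A.X ⟶ A.X) ^ N) (𝟙 A.X)).left ≫
        pullback.fst A.X.hom A.X.hom = (((𝟙 A.X : A.X ⟶ A.X) ^ N) : A.X ⟶ A.X).left :=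
      congrArg Over.Hom.left (CartesianMonoidalCategory.lift_fst _ _)
    have h2' : (CartesianMonoidalCategory.lift ((𝟙 A'.X : A'.X ⟶ A'.X) ^ N) (𝟙 A'.X)).left ≫
        pullback.snd A'.X.hom A'.X.hom = 𝟙 A'.X.left :=
      congrArg Over.Hom.left (CartesianMonoidalCategory.lift_snd _ _)
    have h2 : (CartesianMonoidalCategory.lift ((𝟙 A.X : A.X ⟶ A.X) ^ N) (𝟙 A.X)).left ≫
        pullback.snd A.X.hom A.X.hom = 𝟙 A.X.left :=
      congrArg Over.Hom.left (CartesianMonoidalCategory.lift_snd _ _)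
    have key : (CartesianMonoidalCategory.lift ((𝟙 A'.X : A'.X ⟶ A'.X) ^ N) (𝟙 A'.X)).left ≫
        pullback.map A'.X.hom A'.X.hom A.X.hom A.X.hom G G g w.symm w.symm =
          G ≫ (CartesianMonoidalCategory.lift ((𝟙 A.X : A.X ⟶ A.X) ^ N) (𝟙 A.X)).left := by
      apply pullback.hom_ext
      · erw [Category.assoc, Category.assoc, pullback.lift_fst, reassoc_of% h1', h1]
        exact ih
      · erw [Category.assoc, Category.assoc, pullback.lift_snd, reassoc_of% h2', h2]
        simp
    rw [pow_succ, pow_succ, Hom.mul_def, Hom.mul_def, Over.comp_left, Over.comp_left, Category.assoc, hμ]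
    exact (reassoc_of% key) μ[A.X].left

end IsBaseChangeVia

/-! ## Existence of torsion lifts along a surjective closed immersion, `[N]` étale -/

/-- **Torsion points lift uniquely along a surjective closed immersion when `[N]` is étale** ([SGA1] I Cor. 5.6 «théorème de
prolongement des relèvements» applied to `[N] : X → X`): for an abelian scheme `X/S` with `[N]` ÉTALE (e.g. `N` invertible
on `S`, [GortzWedhorn2023] Prop. 27.187), a surjective closed immersion `i : S₀ → S` and a morphism `a : S₀ → X` over `i`
with `a ≫ [N] = i ≫ η` (an `N`-torsion point of `X ×_S S₀`), there is a UNIQUE section `σ ∈ X(S)` with `σ ^ N = 1`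
restricting to `a`. [cite: SGA1, Exp. I Cor. 5.6] [cite: GortzWedhorn2023, Prop. 27.187] -/
theorem existsUnique_section_pow_eq_one_of_comp {N : ℕ}
    [Etale ((((𝟙 A.X : A.X ⟶ A.X) ^ N) : A.X ⟶ A.X).left)]
    {S₀ : Scheme.{u}} (i : S₀ ⟶ S) [IsClosedImmersion i] [Surjective i] (a : S₀ ⟶ A.X.left)
    (ha : a ≫ (((𝟙 A.X : A.X ⟶ A.X) ^ N) : A.X ⟶ A.X).left = i ≫ η[A.X].left) :
    ∃! σ : A.Sections, σ ^ N = 1 ∧ i ≫ σ.left = a := by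
  obtain ⟨t, ⟨ht₁, ht₂⟩, huniq⟩ :=
    Literature.AlgebraicGeometry.FundamentalGroup.existsUnique_lift_of_etale
      ((((𝟙 A.X : A.X ⟶ A.X) ^ N) : A.X ⟶ A.X).left) i a η[A.X].left ha
  -- `t` is a section of `X → S`: `t ≫ π = η ≫ [N] ≫ π`-free computation `t ≫ π = (t ≫ [N]) ≫ π = η ≫ π = 𝟙`
  have hw : t ≫ A.X.hom = (𝟙_ (Over S)).hom := by
    rw [Over.tensorUnit_hom, ← Over.w ((((𝟙 A.X : A.X ⟶ A.X) ^ N) : A.X ⟶ A.X)), ← Category.assoc, ht₂]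
    exact Over.w η[A.X]
  let σ : A.Sections := Over.homMk t hw
  have hσN : σ ^ N = 1 := by
    ext : 1
    rw [pow_eq_comp_pow_id, Over.comp_left, one_left]
    exact ht₂
  refine ⟨σ, ⟨hσN, ht₁⟩, fun τ ⟨hτN, hτ₀⟩ => ?_⟩
  have hτ' : τ.left ≫ (((𝟙 A.X : A.X ⟶ A.X) ^ N) : A.X ⟶ A.X).left = η[A.X].left := by
    have h := congrArg Over.Hom.left (A.pow_eq_comp_pow_id τ N)
    rw [hτN, one_left, Over.comp_left] at h
    exact h.symm
  ext : 1
  exact huniq τ.left ⟨hτ₀, hτ'⟩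

/-- **Torsion sections lift uniquely along a base-change square over a surjective closed immersion**: if `(G, i)` exhibits
`A₀/S₀` as the base change of `A/S` along a surjective closed immersion `i : S₀ → S` and `[N]_A` is étale, then every
`N`-torsion section `σ₀ ∈ X₀(S₀)` is the restriction of a unique `N`-torsion section `σ ∈ X(S)` (`σ₀ ≫ G = i ≫ σ`).
[cite: SGA1, Exp. I Cor. 5.6] [cite: GortzWedhorn2023, Prop. 27.187] -/
theorem existsUnique_section_pow_eq_one_of_isBaseChangeVia {N : ℕ}
    [Etale ((((𝟙 A.X : A.X ⟶ A.X) ^ N) : A.X ⟶ A.X).left)]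
    {S₀ : Scheme.{u}} {i : S₀ ⟶ S} [IsClosedImmersion i] [Surjective i] {A₀ : AbelianSchemeOver S₀}
    {G : A₀.X.left ⟶ A.X.left} (hG : A₀.IsBaseChangeVia A i G) (σ₀ : A₀.Sections) (hσ₀ : σ₀ ^ N = 1) :
    ∃! σ : A.Sections, σ ^ N = 1 ∧ σ₀.left ≫ G = i ≫ σ.left := by
  have ha : (σ₀.left ≫ G) ≫ (((𝟙 A.X : A.X ⟶ A.X) ^ N) : A.X ⟶ A.X).left = i ≫ η[A.X].left := by
    rw [Category.assoc, ← hG.pow_id_left_comp, ← Category.assoc, ← Over.comp_left, ← pow_eq_comp_pow_id, hσ₀,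
      one_left, hG.2.2.1]
  obtain ⟨σ, ⟨hσN, hσ⟩, huniq⟩ := A.existsUnique_section_pow_eq_one_of_comp i (σ₀.left ≫ G) ha
  exact ⟨σ, ⟨hσN, hσ.symm⟩, fun τ ⟨hτN, hτ⟩ => huniq τ ⟨hτN, hτ.symm⟩⟩

/-! ## Level structures lift uniquely along a surjective closed immersion -/

/-- **Field-valued (indeed reduced) points of `S` factor through any surjective closed immersion `S₀ → S`**: the base
change `T ×_S S₀ → T` is a surjective closed immersion into a reduced scheme, hence an isomorphism (Mathlib
`isIso_of_isClosedImmersion_of_surjective`).  In particular the geometric points of `S₀` and of `S` coincide (e.g. for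
`Spec k → Spec k[ε]`). [cite: SGA1, Exp. I Thm. 5.5 (proof, «immersion fermée bijective»)] -/
theorem exists_comp_eq_of_isClosedImmersion_of_surjective {T S₀ : Scheme.{u}} (i : S₀ ⟶ S) [IsClosedImmersion i]
    [Surjective i] [IsReduced T] (s : T ⟶ S) : ∃ s₀ : T ⟶ S₀, s₀ ≫ i = s := by
  haveI : IsClosedImmersion (pullback.fst s i) := MorphismProperty.pullback_fst _ _ inferInstance
  haveI : Surjective (pullback.fst s i) := MorphismProperty.pullback_fst _ _ inferInstance
  haveI : IsIso (pullback.fst s i) := isIso_of_isClosedImmersion_of_surjective _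
  exact ⟨inv (pullback.fst s i) ≫ pullback.snd s i, by
    rw [Category.assoc, ← pullback.condition, IsIso.inv_hom_id_assoc]⟩

/-- A section of `X ×_S S' → S'` whose composite with `pr₁` is `g ≫ τ` IS the pulled-back section `τ ×_S S'` (both are
`S'`-points of the fibre product with the same two projections). [cite: MumfordFogartyKirwan1994, Ch. 7 §2 Definition 7.2 (p. 129)] -/
theorem sectionBaseChange_eq_of_left_comp_fst {S' : Scheme.{u}} (g : S' ⟶ S) {τ : A.Sections}
    {τ' : (A.baseChange g).Sections} (h : τ'.left ≫ pullback.fst A.X.hom g = g ≫ τ.left) :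
    A.sectionBaseChange g τ = τ' := by
  ext : 1
  have h1 : (A.sectionBaseChange g τ).left ≫ pullback.snd A.X.hom g = 𝟙 S' := Over.w (A.sectionBaseChange g τ)
  have h2 : τ'.left ≫ pullback.snd A.X.hom g = 𝟙 S' := Over.w τ'
  exact pullback.hom_ext ((A.sectionBaseChange_left_comp_fst g τ).trans h.symm) (h1.trans h2.symm)

/-- Two level structures with the same basis sections are equal (the remaining fields are propositions).
[cite: MumfordFogartyKirwan1994, Ch. 7 §2 Definition 7.1 (p. 129)] -/
theorem LevelStructure.ext_of_σ_eq {g₀ n : ℕ} {B : AbelianSchemeOver S} {φ φ' : LevelStructure g₀ n B}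
    (h : φ.σ = φ'.σ) : φ = φ' := by
  obtain ⟨σ, _, _, _⟩ := φ
  obtain ⟨σ', _, _, _⟩ := φ'
  cases h
  rfl

/-- **Level structures lift uniquely along a surjective closed immersion** ([MumfordFogartyKirwan1994] Ch. 7 §2, the «lemma
of Serre» remark after Thm. 7.9: level structures are rigid; here in the infinitesimal direction): let `X/S` be an abelian
scheme with `[N] : X → X` ÉTALE (e.g. `N` invertible on `S`, [GortzWedhorn2023] Prop. 27.187) and `i : S₀ → S` a
surjective closed immersion (a nilpotent thickening, e.g. `Spec k → Spec k[ε]`).  Then every level-`N` structure on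
`X ×_S S₀` is the pull-back of a UNIQUE level-`N` structure on `X`: the basis sections lift uniquely as `N`-torsion
sections ([SGA1] I Cor. 5.6 applied to `[N]`, `existsUnique_section_pow_eq_one_of_isBaseChangeVia`), and the basis
clauses at the geometric points of `S` are those of `S₀` because every geometric point of `S` factors through `i`
(`exists_comp_eq_of_isClosedImmersion_of_surjective`) and the geometric fibres of `X ×_S S₀` are those of `X`
(★ `fibrePointsBaseChangeEquiv`, `restrict_sectionBaseChange`).
[cite: SGA1, Exp. I Cor. 5.6] [cite: GortzWedhorn2023, Prop. 27.187] [cite: MumfordFogartyKirwan1994, Ch. 7 §2 Definition 7.1 (p. 129)] -/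
theorem LevelStructure.existsUnique_baseChange_eq {g₀ N : ℕ}
    [Etale ((((𝟙 A.X : A.X ⟶ A.X) ^ N) : A.X ⟶ A.X).left)]
    {S₀ : Scheme.{u}} (i : S₀ ⟶ S) [IsClosedImmersion i] [Surjective i]
    (φ₀ : LevelStructure g₀ N (A.baseChange i)) :
    ∃! φ : LevelStructure g₀ N A, φ.baseChange i = φ₀ := by
  have hbc := A.baseChange_isBaseChangeVia i
  -- the unique `N`-torsion lifts of the basis sections
  have H : ∀ j, ∃! σ : A.Sections, σ ^ N = 1 ∧ (φ₀.σ j).left ≫ pullback.fst A.X.hom i = i ≫ σ.left := fun j =>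
    A.existsUnique_section_pow_eq_one_of_isBaseChangeVia hbc (φ₀.σ j) (φ₀.pow_σ j)
  choose σ hσ huniq using H
  have hσbc : ∀ j, A.sectionBaseChange i (σ j) = φ₀.σ j := fun j =>
    A.sectionBaseChange_eq_of_left_comp_fst i (hσ j).2
  have hfun : (fun j => A.sectionBaseChange i (σ j)) = φ₀.σ := funext hσbc
  let φ : LevelStructure g₀ N A :=
    { σ := σ
      pow_σ := fun j => (hσ j).1
      basis_injective := by
        intro Ω _ _ s
        obtain ⟨s₀, rfl⟩ := exists_comp_eq_of_isClosedImmersion_of_surjective i s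
        intro a b hab
        have hab' : A.fibrePointsBaseChangeEquiv i s₀ (A.restrict (s₀ ≫ i) (A.sectionPow σ a)) =
            A.fibrePointsBaseChangeEquiv i s₀ (A.restrict (s₀ ≫ i) (A.sectionPow σ b)) := congrArg _ hab
        rw [← restrict_sectionBaseChange, ← restrict_sectionBaseChange, sectionBaseChange_sectionPow,
          sectionBaseChange_sectionPow, hfun] at hab'
        exact φ₀.basis_injective s₀ hab'
      basis_surjective := by
        intro Ω _ _ s
        obtain ⟨s₀, rfl⟩ := exists_comp_eq_of_isClosedImmersion_of_surjective i s
        intro x hx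
        obtain ⟨a, ha⟩ := φ₀.basis_surjective s₀ (A.fibrePointsBaseChangeEquiv i s₀ x)
          (by rw [← map_pow, hx, map_one])
        refine ⟨a, (A.fibrePointsBaseChangeEquiv i s₀).injective ?_⟩
        rw [← restrict_sectionBaseChange, sectionBaseChange_sectionPow, hfun]
        exact ha }
  have hφ : φ.baseChange i = φ₀ := LevelStructure.ext_of_σ_eq (funext fun j => hσbc j)
  refine ⟨φ, hφ, fun φ' hφ' => LevelStructure.ext_of_σ_eq (funext fun j => ?_)⟩
  -- uniqueness: the sections of `φ'` are `N`-torsion lifts of the `φ₀.σ j`, hence equal to `σ j`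
  refine huniq j (φ'.σ j) ⟨φ'.pow_σ j, ?_⟩
  rw [← hφ', LevelStructure.baseChange_σ, sectionBaseChange_left_comp_fst]

end AbelianSchemeOver

end Literature.AlgebraicGeometry.AbelianSchemes

end
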